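import Literature.NumberTheory.EllipticCurves.Kato2004.MemberHullZetaCoreInputs
import Literature.NumberTheory.EllipticCurves.Kato2004.IwasawaH2FineSelmerDualComparison
import HarnessLib

/-!
# Kato 2004 (Astérisque 295) at Kato's member — the HULL SUB-PACKAGE of `MemberHullZetaCoreInputs`:
# the structure `MemberHullZetaFineInputs` (no abstract `𝐇²`, no pinned `A`; Thm. 12.5 (3) read against
# the constructed dual fine Selmer group `X₀(E/ℚ_∞)`) and the fact `exists_memberHullZetaFineInputs`

Topic `NumberTheory/EllipticCurves`, sub-directory `Kato2004` (namespace = path).  Seat `bsd-potss-rkm`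
(generation 30, cell `bsd-potss`; crux M = item stmt-BirchSwinnertonDyer-19196 `ReducibleKatoMember` of the
routes K9 `KatoDescentPotSupersingular` / K8-t′ `KatoDescentTamePotSupersingular`; held child
stmt-BirchSwinnertonDyer-27962 `PublishedInputMemberHullZetaCore := Kato2004.exists_memberHullZetaCoreInputs`),
executing the object-candidate T-M-TAME of the cell's TARGET R294 in the uniform form of the seat's g29 memo
(`run/shared/lean/pub/bsd-potss/rkm/FINDING-19196-rkm-g29.md` §3): a FOURTH sibling of the held package
`MemberHullInputs` / `MemberHullZetaInputs` / `MemberHullZetaCoreInputs` — strictly a SUB-package of the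
last one.  ONE `structure` (hypothesis package, nothing asserted), ONE `def … : Prop` (named fact,
review-queued, net debt +1), two term-level conversions; no instance beyond the structure-carried ones of
the sibling files, no notation, no `sorry`.

WHY.  `MemberHullZetaCoreInputs W p κ γ I 𝐲` (p630270) has thirty-five fields (four of them instance fields) in three blocks:
(H) the HULL block — the reflexive hull `j : 𝐇¹_Γ ↪ F` with finite cokernel (13.14 / Wuthrich L.12),
Kato's normalised zeta element `z = z_{γ⁰} ∈ F`, `z ≠ 0`, `F/Λz` torsion (Thm. 12.5 (1)(2) with 12.4 (2)),
the multiplier `λ ∈ Λ` of Lemma 13.10 (1) with `j 𝐲 = λ•z`, `λ(0) ≠ 0`, and clause (b′) (the local index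
of the zeta line at `p`, Prop. 14.16 (2) `ν` / Lemma 14.18 with Kim §3.2.3); (A) the ABSTRACT-`𝐇²`
block — a finitely generated torsion `Λ`-module `H2` ((12.2.1), Thm. 12.4 (1)), the module
`A = H¹(ℤ[1/p],T)` with its pin, the maps `ι`, `π` of (14.14.1) with the pin of `ι`, `μ(H2) = 0`
(Wuthrich L.14) and clause (c2′) `KatoH2CountAt W p #(H2)_Γ` ((14.14.2) + (14.9.3)); and (D) the one
field COUPLING the two blocks, Thm. 12.5 (3) with Rem. 12.7: `ℓ_𝔮(H2) ≤ ℓ_𝔮(F/Λz)` at every height-one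
`𝔮 ≠ (p)`.  The cell's kernel ledger for crux M (Summits files
`Theorems/KatoDescentPotSupersingularReducibleHullDescentCount`, `…ReducibleHullShaBound{,Tame,Count}`,
seat rkm g29, all accepted) consumes block (H) and, IN PLACE OF block (A), an Iwasawa descent package
`J : IwasawaH2Data W p κ γ I` (Kato's GENUINE `𝐇²_Γ(T_pW)` with (14.14.1), `IwasawaH2Descent.lean`)
carrying an injection `X₀(E/ℚ_∞) = (W.fineSelmerDualData κ hγ).X ↪ J.H2` of finite cokernel — the content
of the reviewed named fact `exists_iwasawaH2Data_fineSelmerDual_embedding` (H2X,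
`IwasawaH2FineSelmerDualComparison.lean`, cell `bsd-cm`, p624791) — with block (D) read AGAINST `X₀`:

  (D₀) `ℓ_𝔮(X₀(E/ℚ_∞)) ≤ ℓ_𝔮(F/Λz)` at every height-one prime `𝔮 ≠ (p)` of `Λ`.

In print (D₀) is Thm. 12.5 (3) (p. 222: "Let `𝔭` be a prime ideal of `Λ` of height one which does not
contain `p`. Then `length_{Λ_𝔭}(𝐇²(V_{F_λ}(f))_𝔭) ≤ length_{Λ_𝔭}(𝐇¹(V_{F_λ}(f))_𝔭 / Z(f)_𝔭) +
length_{Λ_𝔭}(𝐇²_loc(V_{F_λ}(f))_𝔭)`", the last term vanishing unless (12.5.1), i.e. unless `f` is NOT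
potentially good at `p`, Rem. 12.7) COMPOSED WITH the injectivity of `X₀(E/ℚ_∞) → 𝐇²_Γ(T_pW)` (the limit
over the layers of ℚ_∞ of Kato's Poitou–Tate sequence (14.9.1), p. 239, read through the local duality
displayed after (12.2.3), p. 220, exactly as in the module docstring of `IwasawaH2FineSelmerDualComparison.lean`;
the injectivity part needs no finiteness of `W(ℚ_{p,∞})[p^∞]`), on the `Δ`-trivial component and with
`z = z_{γ⁰}`, `Z(f)_𝔮 = Λ_𝔮 z` in the hull as in the siblings.  A COMPOSITE READING of two printed
statements (weaker than print: the identity of `𝐇²` is forgotten), never stronger.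

So `MemberHullZetaFineInputs W p κ γ hγ I 𝐲` := blocks (H) + (D₀): EXACTLY the field list of
`MemberHullZetaCoreInputs` with the nineteen fields (fifteen data/proof fields, four instance fields) {`H2`, `addCommGroupH2`, `moduleH2`, `finite_H2`,
`isTorsion_H2`, `A`, `addCommGroupA`, `moduleA`, `toH1`, `toH1_injective`, `mem_range_toH1_iff`, `toH1_smul`,
`ι`, `π`, `π_surjective`, `exact_ι_π`, `toH1_ι`, `mu_H2`, `katoH2Count`} REMOVED and `divisibility_offP`
re-targeted from `H2` to `(W.fineSelmerDualData κ hγ).X` (whence the extra parameter `hγ`); every other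
field has the SAME name and type.  The fact `exists_memberHullZetaFineInputs` is the outer text of
`exists_memberHullZetaCoreInputs` VERBATIM (with the generator hypothesis named `hγ`).

WHAT THIS BUYS (kernel, Summits-side, seat rkm g30,
`Theorems/KatoDescentPotSupersingularMemberHullCoreInputsOfFine.lean`): from `exists_memberHullZetaFineInputs`,
the one-clause sequel H2X⁺ of H2X (`IwasawaH2FineSelmerDualCount.lean`: H2X's package `J` with (c2′) for ITS
`J`), Ferrero–Washington + Lim 2017 Thm. 3.5 (`μ(X₀) = 0` on the reducible rows, Wuthrich L.14 — kernel
modulo those two classical facts) and the finiteness of `W(ℚ_{p,∞})[p^∞]` at a potentially good `p` (Imai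
1975, displayed), the kernel REBUILDS `exists_memberHullZetaCoreInputs` (conversion `toCoreInputs` below with
`H2 := J.H2`: `μ(J.H2) = μ(X₀) = 0` by pseudo-isomorphism, (D) from (D₀) by equality of height-one lengths,
(14.14.1) and the pins from `J`).  So the abstract block (A) — fifteen data/proof fields about an UNPINNED module —
leaves the trust base of crux M and of the U₀-red nodes of both routes (all keyed to
`exists_memberHullZetaCoreInputs`) in exchange for one printed clause about the `J` of a reviewed fact and Imai's finiteness.
The converse conversion `MemberHullZetaCoreInputs.toFineInputs` needs a comparison `ℓ_𝔮(X₀) ≤ ℓ_𝔮(H2)`,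
which the core package does NOT provide (its `H2` is abstract): the two facts are siblings, neither a
theorem of the other.

HONEST SCOPE.  Nothing is booked; BSD is advanced for no curve; `exists_memberHullZetaFineInputs` is the
transcription of Kato Thm. 12.5 (1)–(3) / 12.6 / Lemma 13.10 (1) / 13.14 / (14.9.1) / Prop. 14.16 (2) `ν`
with Lemma 14.18 (and C.-H. Kim §3.2.3 at an additive `p`) AT KATO'S MEMBER — Kato's Euler system and
explicit reciprocity, no `_holds` expected (size XL, but sixteen fields about the abstract data `F, j, z, λ` and the
pinned `𝐲`, `X₀` instead of thirty-five fields about `F, j, z, λ, 𝐇², A, ι, π`); WEAKER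
than print (the identity of `F` and of `z` is forgotten; (b′) is one direction of the printed index
equality; (D₀) forgets `𝐇²`), never stronger.  JUNK AUDIT: not vacuous (`z ≠ 0`, `λ(0) ≠ 0`, `F/Λz`
torsion and (b′) pin the free parameters: `z := j 𝐲, λ := 1` fails (b′) in general; `F := 0` fails
`j_injective`); not refutable by cooked data (an `∃`); says nothing at `p = 2`, for non-cyclotomic `κ`,
or off the listed rows.  Referee flag `Kato-12.6-13.10-14.18-member-reading-fine-reducible`.
See `MemberHullInputs.lean` ("WHAT THE ABSTRACT FIELDS DO AND DO NOT PIN").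

## References

* K. Kato, *p-adic Hodge theory and values of zeta functions of modular forms*, Astérisque 295 (2004):
  §8.2–8.3 (pp. 180–181), (12.2.1)–(12.2.3) and the display after it (p. 220), Thm. 12.4 (p. 221),
  Thm. 12.5 (1)–(3) (pp. 221–222), Thm. 12.6, Rem. 12.7 (p. 222), 13.9, Lemma 13.10 (1) (pp. 229–230),
  13.14 (p. 234), (14.9.1) (p. 239), (14.9.3) (p. 240), §14.14 (14.14.1)–(14.14.2) (p. 243), Prop. 14.16 (2)
  (pp. 244–245), Lemma 14.18 (pp. 247–248), (17.13.1) (p. 279) — store key `paper:doi-10-24033-ast-639`,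
  pp. 221–222, 239–240, 243 re-read by this seat. [Kato2004Asterisque]
* C.-H. Kim, Amer. J. Math. 148 (2026), §3.2.3 display before Thm. 3.7. [Kim2022StructureSelmer]
* C. Wuthrich, Doc. Math. 19 (2014), Lemma 12 (p. 395), Lemma 14 (p. 396). [Wuthrich2014]
* H. Imai, Proc. Japan Acad. 51 (1975), Theorem (p. 12) — scope remark only. [Imai1975]
* Tree: `MemberHullZetaCoreInputs.lean` (the sibling this file carves), `IwasawaH2FineSelmerDualComparison.lean`
  (H2X; `lengthAt_eq_of_injective_of_finite_quotient`), `IwasawaH2Descent.lean` (`IwasawaH2Data`),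
  `KatoFineSelmerDualProofs.lean` (`WeierstrassCurve.fineSelmerDualData`), `ZetaLineLocalIndex.lean`
  (`ZetaLineOrthIndexAt`), `StrictSelmerH2Count.lean` (`KatoH2CountAt`), `LocPKummerLog.lean` (`layerZeroToTop`).
-/

noncomputable section

open scoped Classical NumberField TensorProduct
open Field IsDedekindDomain CongruenceSubgroup
open Literature.NumberTheory.GaloisRepresentations
open Literature.NumberTheory.EllipticCurves Literature.NumberTheory.EllipticCurves.ModularForms
open Literature.NumberTheory.EllipticCurves.Kato2004
open Literature.NumberTheory.EllipticCurves.Kato2004.EulerSystemValues Rat.HeightOneSpectrum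
open Literature.NumberTheory.EllipticCurves.IwasawaAlgebra

namespace Literature.NumberTheory.EllipticCurves.Kato2004

section Package

variable (W : WeierstrassCurve ℚ) [W.IsElliptic] (p : ℕ) [Fact p.Prime]
  [ContinuousSMul ℤ_[p] (W.tateModule p)] (κ : ZpExtension ℚ p) (γ : absoluteGaloisGroup ℚ)
  (hγ : κ.IsTopGenerator γ) (I : IwasawaH1Data W p κ γ) (y : I.H)

/-- **Kato's rank-`0` descent inputs at his own lattice, HULL SUB-PACKAGE of `MemberHullZetaCoreInputs` —
hypothesis structure (a package of the printed statements; nothing asserted).**  For an elliptic curve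
`W/ℚ` (intended: Kato's member `W_K`, `T_pW ≅ V_{ℤ_p}(f)(1)`), a cyclotomic tower `κ` with topological
generator `γ` (`hγ`), a pinned Iwasawa cohomology `I : IwasawaH1Data W p κ γ` and an element `y : I.H` (the
`Λ`-adic class of a `ZetaBody` family): the reflexive hull `j : I.H ↪ F` with finite cokernel (13.14 /
Wuthrich L.12), Kato's normalised zeta element `z = z_{γ⁰} ∈ F`, `z ≠ 0`, `F/Λz` torsion (Thm. 12.5 (1)(2)),
the multiplier `lam ∈ Λ` of Lemma 13.10 (1) with `j y = lam • z`, `lam(0) ≠ 0`; Thm. 12.5 (3) + Rem. 12.7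
off `(p)` READ AGAINST THE CONSTRUCTED DUAL FINE SELMER GROUP `X₀(E/ℚ_∞) = (W.fineSelmerDualData κ hγ).X`
through the injection `X₀ ↪ 𝐇²_Γ(T_pW)` of (14.9.1) (composite reading); and (b′) the LOCAL INDEX OF THE
ZETA LINE at `p` verbatim as in the sibling.  EXACTLY the field list of `MemberHullZetaCoreInputs` with the
abstract-`𝐇²` / pinned-`A` block (`H2 … katoH2Count`, nineteen fields) removed and `divisibility_offP`
re-targeted at `X₀` (module docstring); same names, types otherwise.
[cite: Kato2004Asterisque, Thm. 12.5 (1)–(3) (pp. 221–222), Thm. 12.6 and Rem. 12.7 (p. 222), Lemma 13.10 (1) (p. 230), 13.14 (p. 234), (14.9.1) (p. 239), Prop. 14.16 (2) (p. 244), Lemma 14.18 (pp. 247–248)]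
[cite: Kim2022StructureSelmer, §3.2.3 display before Thm. 3.7 (PDF p. 16)]
[cite: Wuthrich2014, Lemma 12 (p. 395)] -/
structure MemberHullZetaFineInputs : Type 1 where
  /-- The reflexive hull `F = (𝐇¹_Γ)^{**}` (13.14 / Wuthrich L.12), abstract. -/
  F : Type
  [addCommGroupF : AddCommGroup F]
  [moduleF : _root_.Module (IwasawaAlgebra p) F]
  /-- `F` is finitely generated. -/
  finite_F : Module.Finite (IwasawaAlgebra p) F
  /-- `F` is torsion free. -/
  torsionFree_F : NoZeroSMulDivisors (IwasawaAlgebra p) F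
  /-- The inclusion `𝐇¹_Γ ↪ (𝐇¹_Γ)^{**}`. -/
  j : I.H →ₗ[IwasawaAlgebra p] F
  /-- `j` is injective. -/
  j_injective : Function.Injective j
  /-- The hull has finite (pseudo-null) cokernel. -/
  finite_coker : Finite (F ⧸ LinearMap.range j)
  /-- Kato's normalised zeta element `z_γ⁰` (`γ^+` a `ℤ_p`-basis of `T(−1)^+`), in the hull
  (Thm. 12.6 + 13.14). -/
  z : F
  /-- `z_γ⁰ ≠ 0` (Thm. 12.5 (1) with 13.5 / 14.5 (2)). -/
  z_ne_zero : z ≠ 0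
  /-- Thm. 12.5 (2) with 12.4 (2): `F/Λz` is torsion (rank one). -/
  isTorsion_quotient : Module.IsTorsion (IwasawaAlgebra p) (F ⧸ (IwasawaAlgebra p) ∙ z)
  /-- Lemma 13.10 (1): the multiplier `λ ∈ Λ` of the `(c,d,a(A))`-class. -/
  lam : IwasawaAlgebra p
  /-- Lemma 13.10 (1): `j y = λ • z_γ⁰`. -/
  j_y : j y = lam • z
  /-- `λ(0) ≠ 0` (the admissible `(c,d,a,A)` chosen with `γ_*^+ ≠ 0`). -/
  lam_constantCoeff_ne_zero : PowerSeries.constantCoeff lam ≠ 0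
  /-- Thm. 12.5 (3) with Rem. 12.7 (potentially good `p`), composed with the injection
  `X₀(E/ℚ_∞) ↪ 𝐇²_Γ(T_pW)` of (14.9.1), on the `Δ`-trivial component:
  `ℓ_𝔮(X₀(E/ℚ_∞)) ≤ ℓ_𝔮(F/Λz_γ)` at every height-one `𝔮 ≠ (p)`, for the CONSTRUCTED
  `X₀ = (W.fineSelmerDualData κ hγ).X`. -/
  divisibility_offP : ∀ 𝔮 : PrimeSpectrum (IwasawaAlgebra p), 𝔮.asIdeal.height = 1 →
    𝔮.asIdeal ≠ augIdealP p →
      Module.lengthAt (IwasawaAlgebra p) (W.fineSelmerDualData κ hγ).X 𝔮 ≤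
        Module.lengthAt (IwasawaAlgebra p) (F ⧸ (IwasawaAlgebra p) ∙ z) 𝔮
  /-- (b′) THE LOCAL INDEX OF THE ZETA LINE AT `p` (Prop. 14.16 (2) `ν`, Lemma 14.18; Kim §3.2.3;
  Thm. 12.5 (1) with Lemma 13.10 (1)): `L(W,1)/Ω(W) = q ∈ ℚ`, the exponent
  `e = ord_p q + v_p(λ(0)) + ord_p #W(ℚ_p)[p^∞] − v_p(c_p)` is a natural number, and the bottom class
  `y₀ = proj₀ y` has local index (at least) `p^e` at `p` in the pairing form `ZetaLineOrthIndexAt`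
  (`[H¹(ℚ_p,T)/H¹_f(ℚ_p,T) : ℤ_p ȳ₀] = p^e` in print) — VERBATIM the sibling's clause. -/
  zetaLineIndex : ∃ q : ℚ, W.entireLFunction 1 / (W.realPeriodRat : ℂ) = (q : ℂ) ∧
    ∃ e : ℕ, (e : ℤ) = padicValRat p q + ((PowerSeries.constantCoeff lam).valuation : ℤ) +
        (padicValNat p (Nat.card (AddCommGroup.primaryComponent
          (W.baseChange ((primePlace p).adicCompletion ℚ)).toAffine.Point p)) : ℤ) -
        (padicValNat p ((W.baseChange ((primePlace p).adicCompletion ℚ)).localTamagawaNumber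
          ((primePlace p).adicCompletionIntegers ℚ)) : ℤ) ∧
      ZetaLineOrthIndexAt W p (layerZeroToTop W p κ (I.proj 0 y)) e

attribute [instance] MemberHullZetaFineInputs.addCommGroupF MemberHullZetaFineInputs.moduleF

end Package

/-! ## Term-level conversions (the arithmetic — `μ(J.H2) = 0`, the finiteness inputs — is Summits-side) -/

section Conversions

variable {W : WeierstrassCurve ℚ} [W.IsElliptic] {p : ℕ} [Fact p.Prime]
  [ContinuousSMul ℤ_[p] (W.tateModule p)] {κ : ZpExtension ℚ p} {γ : absoluteGaloisGroup ℚ}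
  {hγ : κ.IsTopGenerator γ} {I : IwasawaH1Data W p κ γ} {y : I.H}

/-- **From the hull sub-package and an Iwasawa descent package `J` containing `X₀` with finite cokernel
(H2X's content) to a `MemberHullZetaCoreInputs` package, GIVEN `μ(J.H2) = 0` and (c2′) for `J`**: the
abstract `𝐇²` is `J.H2`, the pinned `A`, the maps `ι`, `π` and (14.14.1) are `J`'s, Thm. 12.5 (3) for `J.H2`
is (D₀) moved along the pseudo-isomorphism `X₀ ↪ J.H2` (equal lengths at height one,
`lengthAt_eq_of_injective_of_finite_quotient`).  On the reducible rows `μ(J.H2) = μ(X₀) = 0` is a kernel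
theorem modulo Ferrero–Washington + Lim 3.5, and (c2′) for `J` is the clause of the sequel fact H2X⁺ — both
supplied Summits-side. [cite: Kato2004Asterisque, Thm. 12.5 (3) (p. 222), (14.9.1) (p. 239), §14.14 (14.14.1)–(14.14.2) (p. 243)] -/
def MemberHullZetaFineInputs.toCoreInputs (Z : MemberHullZetaFineInputs W p κ γ hγ I y)
    (J : IwasawaH2Data W p κ γ I)
    (eX : (W.fineSelmerDualData κ hγ).X →ₗ[IwasawaAlgebra p] J.H2) (heX : Function.Injective eX)
    (hcokX : Finite (J.H2 ⧸ LinearMap.range eX)) (hmu : muInvariant p J.H2 = 0)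
    (hcount : KatoH2CountAt W p (Nat.card (coinvariants p J.H2))) :
    MemberHullZetaCoreInputs W p κ γ I y where
  F := Z.F
  finite_F := Z.finite_F
  torsionFree_F := Z.torsionFree_F
  j := Z.j
  j_injective := Z.j_injective
  finite_coker := Z.finite_coker
  z := Z.z
  z_ne_zero := Z.z_ne_zero
  isTorsion_quotient := Z.isTorsion_quotient
  lam := Z.lam
  j_y := Z.j_y
  lam_constantCoeff_ne_zero := Z.lam_constantCoeff_ne_zero
  H2 := J.H2
  finite_H2 := J.finite_H2
  isTorsion_H2 := J.isTorsion_H2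
  A := J.A
  toH1 := J.toH1
  toH1_injective := J.toH1_injective
  mem_range_toH1_iff := J.mem_range_toH1_iff
  toH1_smul := J.toH1_smul
  ι := J.ι
  π := J.π
  π_surjective := J.π_surjective
  exact_ι_π := J.exact_ι_π
  toH1_ι := J.toH1_ι
  divisibility_offP := fun 𝔮 h𝔮 hq => by
    rw [← lengthAt_eq_of_injective_of_finite_quotient eX heX hcokX 𝔮 h𝔮.le]
    exact Z.divisibility_offP 𝔮 h𝔮 hq
  mu_H2 := hmu
  zetaLineIndex := Z.zetaLineIndex
  katoH2Count := hcount

/-- **From a `MemberHullZetaCoreInputs` package to the hull sub-package, GIVEN a comparison of height-one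
lengths `ℓ_𝔮(X₀) ≤ ℓ_𝔮(H2)` off `(p)`** (e.g. from an injection `X₀ ↪ H2`).  The core package does NOT
provide such a comparison for its abstract `H2`; the hypothesis records exactly what separates the two
siblings. [cite: Kato2004Asterisque, Thm. 12.5 (3) (p. 222), (14.9.1) (p. 239)] -/
def MemberHullZetaCoreInputs.toFineInputs (Z : MemberHullZetaCoreInputs W p κ γ I y)
    (hγ : κ.IsTopGenerator γ)
    (hX : ∀ 𝔮 : PrimeSpectrum (IwasawaAlgebra p), 𝔮.asIdeal.height = 1 → 𝔮.asIdeal ≠ augIdealP p →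
      Module.lengthAt (IwasawaAlgebra p) (W.fineSelmerDualData κ hγ).X 𝔮 ≤
        Module.lengthAt (IwasawaAlgebra p) Z.H2 𝔮) :
    MemberHullZetaFineInputs W p κ γ hγ I y where
  F := Z.F
  finite_F := Z.finite_F
  torsionFree_F := Z.torsionFree_F
  j := Z.j
  j_injective := Z.j_injective
  finite_coker := Z.finite_coker
  z := Z.z
  z_ne_zero := Z.z_ne_zero
  isTorsion_quotient := Z.isTorsion_quotient
  lam := Z.lam
  j_y := Z.j_y
  lam_constantCoeff_ne_zero := Z.lam_constantCoeff_ne_zero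
  divisibility_offP := fun 𝔮 h𝔮 hq => (hX 𝔮 h𝔮 hq).trans (Z.divisibility_offP 𝔮 h𝔮 hq)
  zetaLineIndex := Z.zetaLineIndex

end Conversions

/-! ## The named fact: the hull sub-package exists at Kato's member -/

/-- **Kato 2004, Thm. 12.5 (1)–(3), 12.6 + Lemma 13.10 (1) + 13.14, (14.9.1), Prop. 14.16 (2)'s local index
`ν` / Lemma 14.18 (with C.-H. Kim §3.2.3 at an additive `p`), AT KATO'S LATTICE `T = V_{ℤ_p}(f)(1)`: the HULL
rank-`0` descent inputs EXIST at Kato's member.**  For every globally minimal elliptic curve `W/ℚ` and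
every prime `p ≠ 2` of ADDITIVE, POTENTIALLY GOOD (`0 ≤ ord_p j(W)`) reduction with `W[p]` REDUCIBLE,
`L(W,1) ≠ 0` and `Ш(W/ℚ)` finite, there is a GLOBALLY MINIMAL curve `W_K/ℚ`, `ℚ`-isogenous to `W` (Kato's
member: `T_pW_K ≅ V_{ℤ_p}(f)(1)`, §8.3 + *AEC* III.4.12 — displayed existentially), such that for the
newform `f` of `W` and every family of complex embeddings `ι` there are witnesses `(κ', Λ', c, d, a, A, z, x)`
with `κ' ≠ 0`, `A ≥ 1`, `(c, 6pA) = 1`, `(d, 6pN) = 1` satisfying `ZetaBody W_K p f ι κ' Λ' c d a A z x`, AND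
for every cyclotomic `ℤ_p`-tower `κ` with topological generator `γ` (`hγ`), every `I : IwasawaH1Data W_K p κ γ`
and THE element `𝐲 ∈ I.H` lifting the corestricted `p`-power levels, the structure
`MemberHullZetaFineInputs W_K p κ γ hγ I 𝐲` is inhabited.  VERBATIM the outer text of
`exists_memberHullZetaCoreInputs` (the generator hypothesis now named `hγ`, since the package mentions the
constructed `X₀ = (W_K.fineSelmerDualData κ hγ).X`) with `MemberHullZetaFineInputs` for
`MemberHullZetaCoreInputs`.  A CONSTRUCTION fact (D-0014): weaker than print (the identity of `F`, `z` is
forgotten; (b′) is one direction of the printed index equality; Thm. 12.5 (3) is composed with (14.9.1)),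
never stronger; nothing asserted; no `_holds` expected (Kato's Euler system, explicit reciprocity).  With
the sequel fact H2X⁺ (`exists_iwasawaH2Data_fineSelmerDual_embedding_count`), Ferrero–Washington, Lim 2017
Thm. 3.5 and Imai's finiteness it REBUILDS `exists_memberHullZetaCoreInputs` in the kernel (Summits-side,
seat rkm g30).  Referee flag `Kato-12.6-13.10-14.18-member-reading-fine-reducible`.
[cite: Kato2004Asterisque, §8.3 (p. 181), Thm. 12.4 (p. 221), Thm. 12.5 (1)–(3) (pp. 221–222), Thm. 12.6 and Rem. 12.7 (p. 222), 13.9 and Lemma 13.10 (1) (pp. 229–230), 13.14 (p. 234), §14.1 (p. 235), (14.9.1) (p. 239), Prop. 14.16 (2) and its proof (pp. 244–245), Lemma 14.18 (pp. 247–248), (8.1.3) (p. 180), Ex. 13.3 (p. 225), Prop. 8.12 (p. 186), Thm. 9.7 (p. 189), Thm. 6.6 (1) (p. 163)]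
[cite: Kim2022StructureSelmer, §3.2.3 display before Thm. 3.7 (PDF p. 16)]
[cite: Wuthrich2014, §3.2 and Lemma 12 (pp. 394–395)]
[cite: SilvermanAEC2009, Prop. III.4.12 with Rem. III.4.13.2] -/
def exists_memberHullZetaFineInputs : Prop :=
  ∀ (W : WeierstrassCurve ℚ) [W.IsElliptic] [W.IsGloballyMinimal] (p : ℕ) [Fact p.Prime]
    (hp : p ≠ 2),
    ¬ W.HasGoodReductionAtPrime p → ¬ W.HasMultiplicativeReductionAtPrime p →
    0 ≤ padicValRat p W.j →
    ¬ W.HasIrreducibleModPGaloisRep p →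
    W.entireLFunction 1 ≠ 0 → Finite W.sha →
    ∃ (W' : WeierstrassCurve ℚ) (_ : W'.IsElliptic) (_ : W'.IsGloballyMinimal),
      WeierstrassCurve.IsIsogenous W W' ∧
      ∀ [ContinuousSMul ℤ_[p] (W'.tateModule p)] [Module.Free ℤ_[p] (W'.tateModule p)]
        [Module.Finite ℤ_[p] (W'.tateModule p)],
      ∀ {N : ℕ} [NeZero N] (f : CuspForm (Gamma0 N) 2), IsNewformOf W f →
      ∀ (ι : (m : ℕ) → (CyclotomicField m ℚ →+* ℂ)),
      ∃ (κ' : ℝ) (Λ' : ∀ (k : ℕ) (r : Finset (HeightOneSpectrum (𝓞 ℚ))),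
          H1 (tateRep W' p) (cycSubgroup p k r) →ₗ[ℤ_[p]] ℚ_[p] ⊗[ℚ] CyclotomicField (cycLevel p k r) ℚ)
        (c d a : ℤ) (A : ℕ)
        (z : ∀ (k : ℕ) (r : (cyclotomicLevelsRat p (badPlaces c d A N)).Ideals),
          H1 (tateRep W' p) ((cyclotomicLevelsRat p (badPlaces c d A N)).level k r.1))
        (x : ∀ (k : ℕ) (r : (cyclotomicLevelsRat p (badPlaces c d A N)).Ideals),
          CyclotomicField (cycLevel p k r.1) ℚ),
        κ' ≠ 0 ∧ 0 < A ∧ Int.gcd c (6 * p * A) = 1 ∧ Int.gcd d (6 * p * N) = 1 ∧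
        ZetaBody W' p f ι κ' Λ' c d a A z x ∧
        ∀ (κ : ZpExtension ℚ p) (γ : absoluteGaloisGroup ℚ) (hκ : κ.IsCyclotomic)
          (hγ : κ.IsTopGenerator γ),
          ∀ (I : IwasawaH1Data W' p κ γ) (y : I.H),
            (∀ n : ℕ, I.proj n y = levelToLayer W' p hκ hp (badPlaces c d A N) n
              (z (n + 1) (cyclotomicLevelsRat p (badPlaces c d A N)).idealOne)) →
            Nonempty (MemberHullZetaFineInputs W' p κ γ hγ I y)

end Literature.NumberTheory.EllipticCurves.Kato2004

end
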